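import Mathlib
import HarnessLib
import Summits.NavierStokesRegularity.NavierStokesRegularity.Theorems.TypeIQuarterGateScarEnvelopeTypeIForcedTsaiAlgDecay

/-!
# ARM B lane E-exact, Type-I-tail class — the EXACT `L⁴` NORM of a witness field (`AlgRow.l4`, portrait information for
  the typed-currency repair; ns-wall-extremal 2026-08-29)

The repaired currency `ForcedTsaiModulusTypeILE C₀ M δ` prints a Type-I constant `C₀`; the kernel's symbolic decay
certificate (`…AlgDecay`) gives a valid but CRUDE `C₀` (no cancellation between monomials).  As an exact, kernel-certified
size measure of the same fields in Tsai's class (`L^q(ℝ³)`, `3 < q < ∞`) this module computes `∫_{ℝ³} ‖U‖⁴ dy` EXACTLY: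
`‖U‖² = Σᵢ uᵢ²` is a 5-polynomial (`AlgRow.u2Poly`), `‖U‖⁴` its square, and every monomial of it converges (each monomial of
`u` has `h ≥ |a|+2k+1`, so `‖U‖⁴`'s have `h ≥ |a|+2k+4 > |a|+2k+3`), whence the landed moment table `Poly5.integrate`
applies: `AlgRow.l4 = some (c₁, c₂)` with `∫‖U‖⁴ = c₁π + c₂π²`; `AlgRow.l4Check K` certifies `∫‖U‖⁴ ≤ K`.
`AlgRow.l4_sound : l4Check K = true → Integrable ‖U‖⁴ ∧ ∫‖U‖⁴ ≤ K`.  Numbers (mirror `v4/l4.py`): ℓ=1 ¼-witness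
`‖U‖_{L⁴} = 0.1545`; 60-element level-16 witness `7.139`; eng-3 larger-basis level-16 vector `7.170` (the floating-point
`sup (1+|y|)|U|` of these fields is ≈ 0.145 / 6.98 / 6.98).  Information about explicit fields; nothing about NS regularity.
-/

noncomputable section

set_option linter.dupNamespace false

namespace Summit.NavierStokesRegularity.NavierStokesRegularity.Cruxes.ScarEnvelopeTypeI.ForcedTsai

open MeasureTheory Set Metric Real Finset
open scoped RealInnerProductSpace ContDiff
open Literature.Analysis.FluidPDE

namespace AlgRow

/-- `‖U‖²` as a 5-polynomial: the sum of the squares of the components of `u = curl5 Ψ`. -/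
def u2Poly (r : AlgRow) : Poly5 :=
  Poly5.add (Poly5.add (Poly5.nmul (r.u 0) (r.u 0)) (Poly5.nmul (r.u 1) (r.u 1))) (Poly5.nmul (r.u 2) (r.u 2))

/-- `∫ ‖U‖⁴ = c₁π + c₂π²` as `(c₁, c₂)`, or `none` if a monomial diverges (shared evaluation of `‖U‖²`). -/
def l4 (r : AlgRow) : Option (ℚ × ℚ) :=
  let U2 := r.u2Poly
  Poly5.integrate r.tau (Poly5.nmul U2 U2)

/-- The `L⁴` check: `0 < τ` and the certified upper enclosure of `∫‖U‖⁴` is `≤ K`. -/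
def l4Check (r : AlgRow) (K : ℚ) : Bool :=
  decide (0 < r.tau) && (match r.l4 with | some c => decide (encHi c ≤ K) | none => false)

/-- `‖U(y)‖⁴` is the value of the symbolic `‖U‖²·‖U‖²`. -/
theorem norm_field_pow_four (r : AlgRow) (y : E3) :
    ‖r.field y‖ ^ 4 = Poly5.eval r.tauR (Poly5.nmul r.u2Poly r.u2Poly) y := by
  rw [show (4 : ℕ) = 2 * 2 from rfl, pow_mul, AlgRow.field, norm_sq_evalVec5, Poly5.eval_nmul, sq]
  rfl

/-- **The exact `L⁴` bound**: a passing check certifies `‖U‖⁴` integrable on `ℝ³` with `∫‖U‖⁴ ≤ K`. -/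
theorem l4_sound (r : AlgRow) (K : ℚ) (h : r.l4Check K = true) :
    Integrable (fun y : E3 => ‖r.field y‖ ^ 4) ∧ ∫ y, ‖r.field y‖ ^ 4 ≤ (K : ℝ) := by
  unfold AlgRow.l4Check at h
  rcases hc : r.l4 with _ | c <;> simp only [hc, Bool.and_false, Bool.and_eq_true, decide_eq_true_eq, Bool.false_eq_true] at h
  obtain ⟨hτ, hK⟩ := h
  have hc' : Poly5.integrate r.tau (Poly5.nmul r.u2Poly r.u2Poly) = some c := hc
  obtain ⟨hint, hval⟩ := integral_poly5 hτ (Poly5.nmul r.u2Poly r.u2Poly) hc'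
  have hτcast : ((r.tau : ℚ) : ℝ) = r.tauR := rfl
  rw [hτcast] at hint hval
  have hfun : (fun y : E3 => ‖r.field y‖ ^ 4) = fun y => Poly5.eval r.tauR (Poly5.nmul r.u2Poly r.u2Poly) y :=
    funext (r.norm_field_pow_four)
  rw [hfun]
  refine ⟨hint, ?_⟩
  rw [hval]
  exact (le_encHi c).trans (by exact_mod_cast hK)

end AlgRow

end Summit.NavierStokesRegularity.NavierStokesRegularity.Cruxes.ScarEnvelopeTypeI.ForcedTsai

end
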